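import Literature.AlgebraicGeometry.ShimuraVarieties.UnitaryCanonicalModelDescentToIntersection
import Literature.AlgebraicGeometry.ShimuraVarieties.UnitaryShimuraCanonicalModelTowerReflex
import HarnessLib

/-!
# hDel consumer cut: Deligne's descent to the intersection (row I-6) ⟹ a model over `τ(L)`, GIVEN the census inclusion
# `⋂_{Φ ∋ τ} E♯(Φ) ⊆ τ(L)`

Summits side, binder subdirectory `CorCM/HypDel/` (cell `hodgecm-mathlib`, seat B-typ04 g2; director g2 ask 2026-08-28T04:36:01Z,
report-first 04:46:25Z).  THEOREMS ONLY (no definition, no named fact, no `sorry`; nothing is discharged).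

The B-side crux workfile `Lines/B1HeckeQuotientDescent.lean` (v10b) reduces `HDel` (stmt-HodgeConjecture-24835) to the printed citation
F1 and ONE residual, `NoSmallReflexBaseDescent` (:1300, stub :1349): for a CM field `L` with frame `τ` such that NO `τ`-adapted CM type
has small reflex, models of the tower with Shimura reciprocity over EVERY reflex compositum `E♯(Φ) = τ(L)·E*(Φ)` (`Φ ∋ τ`) should give
a model over `τ(L)`.  Row I-6 (`UnitaryCanonicalModel.descentToIntersection_printed`, p604396 = [Deligne1971TravauxShimura] Prop. 5.10
read at the unitary tower) descends such a family to the INTERSECTION `E∩ := ⨅_{Φ ∋ τ} E♯(Φ)`; the tower lemma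
(`exists_isCanonicalDescentOver_of_range_subset`) then reaches `τ(L)` exactly when `E∩ ⊆ τ(L)` (the «census inclusion»).

* `isCanonicalDescentOver_iInf_reflexField_of_descentToIntersection` — I-6 at the family of adapted types: a model over `E∩`;
* **`isCanonicalDescentAt_of_descentToIntersection_of_census`** — the body of `NoSmallReflexBaseDescent` with its hypothesis
  «no adapted `Φ` has small reflex» REPLACED by the census inclusion `(E∩ : Set ℂ) ⊆ range τ` (per datum);
* `iInf_reflexField_le_of_hasSmallReflex` — the census inclusion HOLDS as soon as one adapted `Φ` has small reflex (`E∩ ≤ E♯(Φ) = τ(L)`),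
  so the second theorem also covers the small-reflex case of §16 of the workfile.

RESIDUAL SHAPE for the planner's re-cut of `NoSmallReflexBaseDescent` (replace the binder
`(∀ Φ : CMType L, Aux.IsAdapted L Φ τ → ¬ Aux.HasSmallReflex L Φ τ) →` by this one, everything else unchanged):
`((⨅ Φ : {Φ : CMType L // Aux.IsAdapted L Φ τ}, Aux.reflexField L Φ.1 τ : IntermediateField ℚ ℂ) : Set ℂ) ⊆ Set.range τ →`
— then `isCanonicalDescentAt_of_descentToIntersection_of_census h510` IS the re-cut body, by name.

WHY NOT THE STUB VERBATIM (report-first 04:46:25Z, (2)): the census inclusion is NOT a consequence of «no adapted `Φ` has small reflex» —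
it FAILS for every `L` of odd `[L⁺:ℚ]` in that class (for `x ∈ L`, `x̄ = -x`, the element `∏_{φ ∈ Φ, φ ≠ τ} φ(x) = N_Φ(x)/τ(x)` lies in
every `E♯(Φ)`, `Φ ∋ τ`, up to sign, and its square is `(-1)^d N_{L/ℚ}(x)/τ(x)²`; so `E∩ ⊆ τ(L)` with `d` odd forces the imaginary
quadratic subfield `ℚ(√-N(x)) ⊆ L`, whence an adapted type WITH small reflex, `Aux.exists_isAdapted_and_hasSmallReflex_of_quadraticSubfield`);
[Liu2021] Rem. C.15 («it is possible that `⋂_Φ E♯_{V,Φ}` strictly contains `τ'(E)`»).  A global hypothesis «∀ L τ, no small reflex ⇒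
census» would be false, so this file keeps the census inclusion as an honest per-datum hypothesis; for even `[L⁺:ℚ]` it can hold together
with «no small reflex» (e.g. octic `L` with `Gal(L^c/ℚ)` of order 32 over a `D₄`-quartic `L⁺`).  HC_CM is proved only modulo the 7 printed
citations until rung 0 closes; this file discharges no binder.

## References
* [Deligne1971TravauxShimura] P. Deligne, *Travaux de Shimura*, Sém. Bourbaki 389, LNM 244 (1971), Prop. 5.10 + Lemme 5.10.1 pp. 157–158,
  Déf. 3.13 p. 141.
* [Liu2021] Y. Liu, App. C Lem. C.14, Rem. C.15 (p. 113).
* [Milne2005ShimuraVarieties] J. S. Milne, *Introduction to Shimura varieties*, Def. 12.8 (62) p. 114.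
* [Shimura1998] G. Shimura, *Abelian Varieties with Complex Multiplication and Modular Functions*, §8.3 Prop. 28.
-/

set_option autoImplicit false

noncomputable section

open Function MulAction NumberField IsDedekindDomain CategoryTheory CategoryTheory.Limits Matrix
open scoped Matrix ComplexOrder
open Literature.AlgebraicGeometry Literature.AlgebraicGeometry.Motives
open Literature.NumberTheory.Automorphic Literature.NumberTheory.Automorphic.UnitaryGroup
open Literature.NumberTheory.Automorphic.Liu2021.AppendixC (C5.OpenCompactSubgroup C5.SmallLevel)
open Literature.Geometry.ComplexHyperbolic Literature.Geometry.ComplexHyperbolic.BallModel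
open Literature.NumberTheory.Automorphic.ShimuraDissection
open Literature.AlgebraicGeometry.ShimuraVarieties
open Literature.AlgebraicGeometry.ShimuraVarieties.UnitaryCanonicalModel

namespace Summit.HodgeConjecture.CorCM.HypDel

variable {L : Type} [Field L] [NumberField L] [IsCMField L]

omit [IsCMField L] in
/-- The `τ`-adapted CM types form a finite type (a CM type is a set of the finitely many complex embeddings). [cite: Shimura1998, §8.3 Prop. 28] -/
theorem finite_adaptedCMType (τ : L →+* ℂ) : Finite {Φ : CMType L // Aux.IsAdapted L Φ τ} :=
  haveI : Finite (CMType L) := Finite.of_injective (fun Θ : CMType L => Θ.1) Subtype.val_injective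
  inferInstance

/-- There is a `τ`-adapted CM type (`Aux.exists_isAdapted`). [cite: Liu2021, App. C §C.3 p. 113] -/
theorem nonempty_adaptedCMType (τ : L →+* ℂ) : Nonempty {Φ : CMType L // Aux.IsAdapted L Φ τ} :=
  let ⟨Φ, hΦ⟩ := Aux.exists_isAdapted (L := L) τ
  ⟨⟨Φ, hΦ⟩⟩

omit [IsCMField L] in
/-- **The census inclusion holds in the small-reflex case**: if some adapted `Φ₀` has small reflex then
`⨅_{Φ adapted} E♯(Φ) ≤ E♯(Φ₀) = τ(L)` (`Aux.reflexField_eq_of_hasSmallReflex`). [cite: Liu2021, App. C Rem. C.15 (p. 113)] -/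
theorem iInf_reflexField_le_of_hasSmallReflex (τ : L →+* ℂ) {Φ₀ : CMType L} (h₀ : Aux.IsAdapted L Φ₀ τ)
    (hs : Aux.HasSmallReflex L Φ₀ τ) :
    ((⨅ Φ : {Φ : CMType L // Aux.IsAdapted L Φ τ}, Aux.reflexField L Φ.1 τ : IntermediateField ℚ ℂ) : Set ℂ) ⊆
      Set.range τ := by
  intro z hz
  have hz₀ : z ∈ Aux.reflexField L Φ₀ τ :=
    (iInf_le (fun Φ : {Φ : CMType L // Aux.IsAdapted L Φ τ} => Aux.reflexField L Φ.1 τ) ⟨Φ₀, h₀⟩) hz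
  rw [Aux.reflexField_eq_of_hasSmallReflex L hs] at hz₀
  obtain ⟨x, hx⟩ := hz₀
  exact ⟨x, hx⟩

variable {H : Matrix (Fin 3) (Fin 3) L} {τ : L →+* ℂ} {T : GL (Fin 3) ℂ}
  {hT : formCongr (starRingEnd ℂ) T (H.map τ) = BallModel.J}
  {K₀ : C5.OpenCompactSubgroup ↥(finAdelic (↥(maximalRealSubfield L)) L (IsCMField.complexConj L) 3 H)}

/-- **Row I-6 at the family of adapted types.**  For an hDel datum (signature `(2,1)` at `τ`, definite elsewhere, anisotropic, neat
small levels) and a complex record system `Sc`, models with Shimura reciprocity over every `E♯(Φ)`, `Φ ∋ τ`, give one over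
`E∩ = ⨅_{Φ ∋ τ} E♯(Φ)` — [Deligne1971TravauxShimura] Prop. 5.10 (`descentToIntersection_printed`) with `E_Φ := E♯(Φ)` (number fields
containing `τ(L)`: `Aux.numberField_reflexField`, `Aux.apply_mem_reflexField`).
[cite: Deligne1971TravauxShimura, Prop. 5.10 p. 157] [cite: Liu2021, App. C Lem. C.14 (p. 113)] -/
theorem isCanonicalDescentOver_iInf_reflexField_of_descentToIntersection (h510 : descentToIntersection_printed)
    (hpos : ∀ τ' : L →+* ℂ, InfinitePlace.mk τ' ≠ InfinitePlace.mk τ → (H.map τ').PosDef)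
    (hanis : ∀ v : Fin 3 → L, hermForm (cmConjRingHom L) H v v = 0 → v = 0)
    (htf : ∀ g : finAdelic (↥(maximalRealSubfield L)) L (IsCMField.complexConj L) 3 H,
      ∀ γ ∈ arithmeticLevel (↥(maximalRealSubfield L)) L (IsCMField.complexConj L) 3 H
        (K₀.1.map (MulAut.conj g).toMonoidHom), IsOfFinOrder γ → γ = 1)
    (Sc : ComplexRecordSystem L H τ T hT K₀)
    (hover : ∀ Φ : CMType L, Aux.IsAdapted L Φ τ →
      ∃ (M : C5.SmallLevel K₀ ⥤ SchemeOver ↥(Aux.reflexField L Φ τ))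
        (e' : (M ⋙ Motives.baseChange ↥(Aux.reflexField L Φ τ) ℂ) ≅ Sc.Mc),
        IsCanonicalDescentOver Sc (algebraMap ↥(Aux.reflexField L Φ τ) ℂ) M e') :
    ∃ (M : C5.SmallLevel K₀ ⥤ SchemeOver ↥(⨅ Φ : {Φ : CMType L // Aux.IsAdapted L Φ τ}, Aux.reflexField L Φ.1 τ))
      (e : (M ⋙ Motives.baseChange ↥(⨅ Φ : {Φ : CMType L // Aux.IsAdapted L Φ τ}, Aux.reflexField L Φ.1 τ) ℂ) ≅ Sc.Mc),
      IsCanonicalDescentOver Sc (algebraMap _ ℂ) M e := by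
  haveI := finite_adaptedCMType (L := L) τ
  haveI := nonempty_adaptedCMType (L := L) τ
  have hfin : ∀ Φ : {Φ : CMType L // Aux.IsAdapted L Φ τ}, FiniteDimensional ℚ ↥(Aux.reflexField L Φ.1 τ) := fun Φ => by
    haveI := Aux.numberField_reflexField L Φ.1 τ
    infer_instance
  exact h510 L H τ T hT hpos hanis K₀ htf Sc {Φ : CMType L // Aux.IsAdapted L Φ τ} (fun Φ => Aux.reflexField L Φ.1 τ) hfin
    (fun Φ x => Aux.apply_mem_reflexField L Φ.1 τ x) (fun Φ => hover Φ.1 Φ.2) _ rfl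

omit [Field L] [NumberField L] [IsCMField L] in
/-- **hDel consumer cut (I-6 ⟹ model over `τ(L)` under the census inclusion).**  The body of the workfile's `NoSmallReflexBaseDescent`
(v10b :1300) with the hypothesis «no adapted `Φ` has small reflex» REPLACED by the per-datum census inclusion
`⨅_{Φ ∋ τ} E♯(Φ) ⊆ τ(L)`: row I-6 gives a model over the intersection (`isCanonicalDescentOver_iInf_reflexField_of_descentToIntersection`),
the tower lemma `exists_isCanonicalDescentOver_of_range_subset` transports it along `E∩ ⊆ τ(L)` to an `L`-form along `τ`, and at base
`(L, τ)` the predicate `IsCanonicalDescentOver` IS `IsCanonicalDescentAt` (`isCanonicalDescentOver_iff`, definitional).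
[cite: Deligne1971TravauxShimura, Prop. 5.10 p. 157 and Déf. 3.13 p. 141] [cite: Milne2005ShimuraVarieties, Def. 12.8 (62) p. 114]
[cite: Liu2021, App. C Rem. C.15 (p. 113)] -/
theorem isCanonicalDescentAt_of_descentToIntersection_of_census (h510 : descentToIntersection_printed) :
    ∀ (L : Type) [Field L] [NumberField L] [IsCMField L] (H : Matrix (Fin 3) (Fin 3) L) (τ : L →+* ℂ)
      (T : GL (Fin 3) ℂ) (hT : formCongr (starRingEnd ℂ) T (H.map τ) = BallModel.J),
      (∀ τ' : L →+* ℂ, InfinitePlace.mk τ' ≠ InfinitePlace.mk τ → (H.map τ').PosDef) →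
      (∀ v : Fin 3 → L, hermForm (cmConjRingHom L) H v v = 0 → v = 0) →
      ∀ K₀ : C5.OpenCompactSubgroup ↥(finAdelic (↥(maximalRealSubfield L)) L (IsCMField.complexConj L) 3 H),
        (∀ g : finAdelic (↥(maximalRealSubfield L)) L (IsCMField.complexConj L) 3 H,
          ∀ γ ∈ arithmeticLevel (↥(maximalRealSubfield L)) L (IsCMField.complexConj L) 3 H
            (K₀.1.map (MulAut.conj g).toMonoidHom), IsOfFinOrder γ → γ = 1) →
        ∀ Sc : ComplexRecordSystem L H τ T hT K₀,
          ((⨅ Φ : {Φ : CMType L // Aux.IsAdapted L Φ τ}, Aux.reflexField L Φ.1 τ : IntermediateField ℚ ℂ) : Set ℂ) ⊆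
              Set.range τ →
          (∀ Φ : CMType L, Aux.IsAdapted L Φ τ →
            ∃ (M : C5.SmallLevel K₀ ⥤ SchemeOver ↥(Aux.reflexField L Φ τ))
              (e' : (M ⋙ Motives.baseChange ↥(Aux.reflexField L Φ τ) ℂ) ≅ Sc.Mc),
              IsCanonicalDescentOver Sc (algebraMap ↥(Aux.reflexField L Φ τ) ℂ) M e') →
          ∃ (M : C5.SmallLevel K₀ ⥤ SchemeOver L) (e : (M ⋙ Motives.baseChangeHom τ) ≅ Sc.Mc),
            IsCanonicalDescentAt Sc M e := by
  intro L _ _ _ H τ T hT hpos hanis K₀ htf Sc hcensus hover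
  obtain ⟨M₀, e₀, h₀⟩ :=
    isCanonicalDescentOver_iInf_reflexField_of_descentToIntersection h510 hpos hanis htf Sc hover
  have hrange : Set.range (algebraMap ↥(⨅ Φ : {Φ : CMType L // Aux.IsAdapted L Φ τ}, Aux.reflexField L Φ.1 τ) ℂ) ⊆
      Set.range τ := by
    rintro _ ⟨z, rfl⟩
    exact hcensus z.2
  obtain ⟨M, e, h⟩ := exists_isCanonicalDescentOver_of_range_subset Sc τ (algebraMap _ ℂ) hrange M₀ e₀ h₀
  exact ⟨M, e, (isCanonicalDescentOver_iff Sc M e).1 h⟩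

/-- **Corollary: the small-reflex case through I-6.**  If SOME adapted `Φ₀` has small reflex, the census inclusion holds
(`iInf_reflexField_le_of_hasSmallReflex`), so models over all `E♯(Φ)` descend to `τ(L)`. [cite: Deligne1971TravauxShimura, Prop. 5.10 p. 157]
[cite: Liu2021, App. C Rem. C.15 (p. 113)] -/
theorem isCanonicalDescentAt_of_descentToIntersection_of_hasSmallReflex (h510 : descentToIntersection_printed)
    (hpos : ∀ τ' : L →+* ℂ, InfinitePlace.mk τ' ≠ InfinitePlace.mk τ → (H.map τ').PosDef)
    (hanis : ∀ v : Fin 3 → L, hermForm (cmConjRingHom L) H v v = 0 → v = 0)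
    (htf : ∀ g : finAdelic (↥(maximalRealSubfield L)) L (IsCMField.complexConj L) 3 H,
      ∀ γ ∈ arithmeticLevel (↥(maximalRealSubfield L)) L (IsCMField.complexConj L) 3 H
        (K₀.1.map (MulAut.conj g).toMonoidHom), IsOfFinOrder γ → γ = 1)
    (Sc : ComplexRecordSystem L H τ T hT K₀) {Φ₀ : CMType L} (h₀ : Aux.IsAdapted L Φ₀ τ) (hs : Aux.HasSmallReflex L Φ₀ τ)
    (hover : ∀ Φ : CMType L, Aux.IsAdapted L Φ τ →
      ∃ (M : C5.SmallLevel K₀ ⥤ SchemeOver ↥(Aux.reflexField L Φ τ))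
        (e' : (M ⋙ Motives.baseChange ↥(Aux.reflexField L Φ τ) ℂ) ≅ Sc.Mc),
        IsCanonicalDescentOver Sc (algebraMap ↥(Aux.reflexField L Φ τ) ℂ) M e') :
    ∃ (M : C5.SmallLevel K₀ ⥤ SchemeOver L) (e : (M ⋙ Motives.baseChangeHom τ) ≅ Sc.Mc), IsCanonicalDescentAt Sc M e :=
  isCanonicalDescentAt_of_descentToIntersection_of_census h510 L H τ T hT hpos hanis K₀ htf Sc
    (iInf_reflexField_le_of_hasSmallReflex τ h₀ hs) hover

/-! ### Generic junction: ANY finite family of model fields whose intersection lies in `τ(L)` (the K-twist consumer) -/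

omit [Field L] [NumberField L] [IsCMField L] in
/-- **Generic junction (any finite nonempty family).**  Row I-6 for an arbitrary finite nonempty family `(E_i)` of number fields inside
`ℂ` containing `τ(L)`, each carrying a model of the tower with Shimura reciprocity, followed by the transport along `⋂ E_i ⊆ τ(L)`: a model
AT `τ(L)` (`IsCanonicalDescentAt`).  `isCanonicalDescentAt_of_descentToIntersection_of_census` is the instance «`E_Φ = E♯(Φ)`, `Φ` adapted»;
the K-twist line (A-p05 2026-08-28T05:27:30Z: two auxiliary CM extensions `L(√-p)`, `L(√-q)` with reflex composita `≤ τL(i√p)`, `≤ τL(i√q)`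
meeting in `τ(L)`) is the instance `ι := Bool` below. [cite: Deligne1971TravauxShimura, Prop. 5.10 p. 157 and Déf. 3.13 p. 141]
[cite: Deligne1979ShimuraVarieties, Prop. 2.3.10 (PDF p. 32 of Milne's translation)] [cite: Milne2005ShimuraVarieties, Def. 12.8 (62) p. 114] -/
theorem isCanonicalDescentAt_of_descentToIntersection_of_family (h510 : descentToIntersection_printed) :
    ∀ (L : Type) [Field L] [NumberField L] [IsCMField L] (H : Matrix (Fin 3) (Fin 3) L) (τ : L →+* ℂ)
      (T : GL (Fin 3) ℂ) (hT : formCongr (starRingEnd ℂ) T (H.map τ) = BallModel.J),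
      (∀ τ' : L →+* ℂ, InfinitePlace.mk τ' ≠ InfinitePlace.mk τ → (H.map τ').PosDef) →
      (∀ v : Fin 3 → L, hermForm (cmConjRingHom L) H v v = 0 → v = 0) →
      ∀ K₀ : C5.OpenCompactSubgroup ↥(finAdelic (↥(maximalRealSubfield L)) L (IsCMField.complexConj L) 3 H),
        (∀ g : finAdelic (↥(maximalRealSubfield L)) L (IsCMField.complexConj L) 3 H,
          ∀ γ ∈ arithmeticLevel (↥(maximalRealSubfield L)) L (IsCMField.complexConj L) 3 H
            (K₀.1.map (MulAut.conj g).toMonoidHom), IsOfFinOrder γ → γ = 1) →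
        ∀ Sc : ComplexRecordSystem L H τ T hT K₀,
          ∀ (ι : Type) [Finite ι] [Nonempty ι] (Ei : ι → IntermediateField ℚ ℂ),
            (∀ i, FiniteDimensional ℚ (Ei i)) → (∀ i (x : L), τ x ∈ Ei i) →
            (∀ i, ∃ (M : C5.SmallLevel K₀ ⥤ SchemeOver ↥(Ei i)) (e : (M ⋙ Motives.baseChange ↥(Ei i) ℂ) ≅ Sc.Mc),
              IsCanonicalDescentOver Sc (algebraMap ↥(Ei i) ℂ) M e) →
            (((⨅ i, Ei i : IntermediateField ℚ ℂ) : Set ℂ) ⊆ Set.range τ) →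
            ∃ (M : C5.SmallLevel K₀ ⥤ SchemeOver L) (e : (M ⋙ Motives.baseChangeHom τ) ≅ Sc.Mc),
              IsCanonicalDescentAt Sc M e := by
  intro L _ _ _ H τ T hT hpos hanis K₀ htf Sc ι _ _ Ei hfin hτ hover hcap
  obtain ⟨M₀, e₀, h₀⟩ := h510 L H τ T hT hpos hanis K₀ htf Sc ι Ei hfin hτ hover _ rfl
  have hrange : Set.range (algebraMap ↥(⨅ i, Ei i) ℂ) ⊆ Set.range τ := by
    rintro _ ⟨z, rfl⟩
    exact hcap z.2
  obtain ⟨M, e, h⟩ := exists_isCanonicalDescentOver_of_range_subset Sc τ (algebraMap _ ℂ) hrange M₀ e₀ h₀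
  exact ⟨M, e, (isCanonicalDescentOver_iff Sc M e).1 h⟩

/-- **Two model fields meeting in `τ(L)`** (the shape of the K-twist closing step: `E₁ = E♯_p ≤ τL(i√p)`, `E₂ = E♯_q ≤ τL(i√q)`,
`E₁ ⊓ E₂ ⊆ τ(L)`): models with reciprocity over `E₁` and `E₂` give a model AT `τ(L)` — `isCanonicalDescentAt_of_descentToIntersection_of_family`
at `ι := Bool`. [cite: Deligne1971TravauxShimura, Prop. 5.10 p. 157] [cite: Deligne1979ShimuraVarieties, Prop. 2.3.10 (PDF p. 32 of Milne's translation)] -/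
theorem isCanonicalDescentAt_of_descentToIntersection_of_pair (h510 : descentToIntersection_printed)
    (hpos : ∀ τ' : L →+* ℂ, InfinitePlace.mk τ' ≠ InfinitePlace.mk τ → (H.map τ').PosDef)
    (hanis : ∀ v : Fin 3 → L, hermForm (cmConjRingHom L) H v v = 0 → v = 0)
    (htf : ∀ g : finAdelic (↥(maximalRealSubfield L)) L (IsCMField.complexConj L) 3 H,
      ∀ γ ∈ arithmeticLevel (↥(maximalRealSubfield L)) L (IsCMField.complexConj L) 3 H
        (K₀.1.map (MulAut.conj g).toMonoidHom), IsOfFinOrder γ → γ = 1)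
    (Sc : ComplexRecordSystem L H τ T hT K₀) (E₁ E₂ : IntermediateField ℚ ℂ) [hE₁ : FiniteDimensional ℚ E₁]
    [hE₂ : FiniteDimensional ℚ E₂]
    (h₁ : ∀ x : L, τ x ∈ E₁) (h₂ : ∀ x : L, τ x ∈ E₂)
    (hM₁ : ∃ (M : C5.SmallLevel K₀ ⥤ SchemeOver ↥E₁) (e : (M ⋙ Motives.baseChange ↥E₁ ℂ) ≅ Sc.Mc),
      IsCanonicalDescentOver Sc (algebraMap ↥E₁ ℂ) M e)
    (hM₂ : ∃ (M : C5.SmallLevel K₀ ⥤ SchemeOver ↥E₂) (e : (M ⋙ Motives.baseChange ↥E₂ ℂ) ≅ Sc.Mc),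
      IsCanonicalDescentOver Sc (algebraMap ↥E₂ ℂ) M e)
    (hcap : ((E₁ ⊓ E₂ : IntermediateField ℚ ℂ) : Set ℂ) ⊆ Set.range τ) :
    ∃ (M : C5.SmallLevel K₀ ⥤ SchemeOver L) (e : (M ⋙ Motives.baseChangeHom τ) ≅ Sc.Mc), IsCanonicalDescentAt Sc M e := by
  refine isCanonicalDescentAt_of_descentToIntersection_of_family h510 L H τ T hT hpos hanis K₀ htf Sc Bool
    (fun b => cond b E₁ E₂) (fun b => ?_) (fun b x => ?_) (fun b => ?_) ?_
  · cases b
    · exact hE₂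
    · exact hE₁
  · cases b
    · exact h₂ x
    · exact h₁ x
  · cases b
    · exact hM₂
    · exact hM₁
  · rw [iInf_bool_eq]
    exact hcap

end Summit.HodgeConjecture.CorCM.HypDel

end
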